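import Mathlib
import Summits.CriticalPhenomena.Ising3DConformalLimit.Theorems.HyperoctahedralRPHRP2RigidityMellinAxialSymmetry
import Literature.MathematicalPhysics.QuantumFieldTheory.MirrorRPKernel
import HarnessLib

/-!
# Crux `PrecisionLaplacian.StableConeRPRigidity` (stmt-CriticalPhenomena-4800), line
# `entire-profile-null-growth` — stub S7 `stub_mellinAxialSymmetry`:
# Mellin uniqueness in the probe exponent, and generation of `O(3)`

The registered stub, restated verbatim: a kernel `K` on `ℝ³`, continuous and positive off the
origin, homogeneous of degree `-β` (`β > 0`), invariant under the nine lattice mirrors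
`eᵢ, eᵢ ± eⱼ`, whose probed axial X-rays `y ↦ ∫ K(y + s eᵢ) |s|^{-δ} ds` (`y ⊥ eᵢ`, `y ≠ 0`) are
radial for every axis `eᵢ` and every probe exponent `δ` with `0 < δ`, `1 - β < δ < 1`, is invariant
under every linear isometry of `ℝ³`.

## This statement is shared by two cruxes of the problem

The SAME text is the registered stub S7 of the sibling crux `HyperoctahedralRP.HRP2Rigidity`
(stmt-CriticalPhenomena-1979, line `xray-mellin-transfer`), proved in the tree as
`Summit.CriticalPhenomena.Ising3DConformalLimit.Cruxes.HRP2Rigidity.XRayMellin.stub_mellinAxialSymmetry`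
(`Theorems/HyperoctahedralRPHRP2RigidityMellinAxialSymmetry.lean`: slices `K(v + t e)` are even,
continuous, `O(t^{-β})`; `∫ f |s|^{-δ} = 2·mellin f (1-δ)`; identity theorem on the strip
`0 < re z < β`; Mellin inversion on a vertical line; two axes generate `O(3)`).  The skeleton of
the present line consumes the stub under ITS OWN fully qualified name
(`…Cruxes.StableConeRPRigidity.EntireProfileNullGrowth.stub_mellinAxialSymmetry`), so this file
re-exports the proved theorem under that name instead of duplicating a 300-line proof.  The
general one-dimensional uniqueness theorem behind both ("an even continuous `f = O(|s|^{-β})` is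
determined by its moments `∫ f(s)|s|^{-δ} ds` on an interval of exponents") is available
independently as `Literature.Analysis.SpecialFunctions.eq_of_integral_mul_abs_rpow_neg_eq`
(`Literature/Analysis/SpecialFunctions/MellinUniqueness.lean`).
-/

open MeasureTheory
open scoped BigOperators

namespace Summit.CriticalPhenomena.Ising3DConformalLimit.Cruxes.StableConeRPRigidity.EntireProfileNullGrowth

/-- **S7 · Mellin uniqueness in the probe exponent, and generation of `O(3)`** (registered stub
`stub_mellinAxialSymmetry` of the line `entire-profile-null-growth`, statement verbatim).
If `K` is continuous and positive off `0`, homogeneous of degree `-β < 0`, nine-mirror invariant,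
and for every `δ` with `0 < δ`, `1 - β < δ < 1` the probed X-rays `∫ K(y + s eᵢ)|s|^{-δ} ds` are
radial about every axis, then `K` is `O(3)`-invariant.  Proof: this is literally the theorem
`Cruxes.HRP2Rigidity.XRayMellin.stub_mellinAxialSymmetry` of the sibling crux (same registered
text), re-exported under the name this line's skeleton consumes. -/
theorem stub_mellinAxialSymmetry :
    ∀ (β : ℝ) (K : EuclideanSpace ℝ (Fin 3) → ℝ), 0 < β →
      ContinuousOn K {0}ᶜ → (∀ x, x ≠ 0 → 0 < K x) →
      (∀ c : ℝ, 0 < c → ∀ x, K (c • x) = c ^ (-β) * K x) →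
      (∀ n : EuclideanSpace ℝ (Fin 3), (∃ i j : Fin 3, i ≠ j ∧ (n = EuclideanSpace.single i 1 ∨ n = EuclideanSpace.single i 1 + EuclideanSpace.single j 1 ∨
        n = EuclideanSpace.single i 1 - EuclideanSpace.single j 1)) →
        ∀ x, K (((ℝ ∙ n)ᗮ).reflection x) = K x) →
      (∀ δ : ℝ, 0 < δ → 1 - β < δ → δ < 1 →
        ∀ (i : Fin 3) (y y' : EuclideanSpace ℝ (Fin 3)), inner ℝ y (EuclideanSpace.single i (1:ℝ)) = 0 →
          inner ℝ y' (EuclideanSpace.single i (1:ℝ)) = 0 → y ≠ 0 → ‖y‖ = ‖y'‖ →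
          ∫ s : ℝ, K (y + s • EuclideanSpace.single i (1:ℝ)) * |s| ^ (-δ) =
            ∫ s : ℝ, K (y' + s • EuclideanSpace.single i (1:ℝ)) * |s| ^ (-δ)) →
      ∀ (R : EuclideanSpace ℝ (Fin 3) ≃ₗᵢ[ℝ] EuclideanSpace ℝ (Fin 3)) (x : EuclideanSpace ℝ (Fin 3)), K (R x) = K x := by
  exact Summit.CriticalPhenomena.Ising3DConformalLimit.Cruxes.HRP2Rigidity.XRayMellin.stub_mellinAxialSymmetry

end Summit.CriticalPhenomena.Ising3DConformalLimit.Cruxes.StableConeRPRigidity.EntireProfileNullGrowth
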